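import Literature.AlgebraicGeometry.Morphisms.CechH1Pullback
import HarnessLib

/-!
# Refinement maps on Čech cochains and on `Ȟ¹(𝒰, 𝒪_X)`; injectivity of `Ȟ¹` under refinement

For a scheme `f : X → Spec A` over a ring `A`, `Morphisms/CechH1` defines the Čech complex of the
structure sheaf in degrees `≤ 2` for an arbitrary family of opens `U : ι → X.Opens` and
`Ȟ¹(𝒰, 𝒪_X) = CechH1 f U`; `Morphisms/CechH1Pullback` its functoriality in the space. This file
adds the functoriality in the covering (Görtz–Wedhorn II, (21.16), Def. 21.71: a *map of
coverings* `𝒱 → 𝒰` is `τ : J → I` with `V_j ⊆ U_{τ(j)}`, inducing `Čⁿ(𝒰, 𝓕) → Čⁿ(𝒱, 𝓕)` by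
restriction, compatible with the differentials; The Stacks Project, Tag 09UY):

* `cechRefineC0/C1/C2` — `(ρ c)_{j j'} = c_{τ j, τ j'} |_{V_j ∩ V_{j'}}`, commuting with `d⁰`, `d¹`
  (`cechD0_refineC0`, `cechD1_refineC1`), hence preserving cocycles and coboundaries;
* `cechRefineH1 : Ȟ¹(𝒰, 𝒪_X) →ₗ[A] Ȟ¹(𝒱, 𝒪_X)`;
* `cechRefineH1_injective` — **the refinement map on `Ȟ¹` is injective** as soon as `𝒱` covers
  every `U_i` (for coverings of a space this is the injectivity of `Ȟ¹(𝒰, 𝓕) → Ȟ¹(X, 𝓕) ≅ H¹(X, 𝓕)`,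
  Görtz–Wedhorn II, Cor. 21.81; the direct cocycle proof given here glues `b_i` from
  `e_j + c_{τ j, i}` on `U_i ∩ V_j` by the sheaf property of `𝒪_X`);
* `cechComapC1_refineC1`, `cechComapH1_refineH1` — refinement commutes with the pullback `g^*`
  of `Morphisms/CechH1Pullback` (`g⁻¹𝒱` refines `g⁻¹𝒰` by the same `τ`);
* `cechZ1_le_cechB1_of_forall_le` — `Ȟ¹(𝒰, 𝒪_X) = 0` when one member `U_{i₀}` contains all the
  others (the cone `b_i = c_{i₀ i}`; e.g. `U_{i₀} = X`).

Families need not cover `X` (the Čech groups of `Morphisms/CechH1` are defined for any family), so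
the same statements serve for the "local" Čech groups of a covering restricted to an open. These
are the cover-independence tools used for the Künneth injectivity of `Motives/KunnethH1Slices`.
Mathlib searched (pin): `TopCat.Sheaf.existsUnique_gluing'`, `TopCat.Sheaf.eq_of_locally_eq'`,
`Scheme.Hom.preimage_iSup`, `inf_iSup_eq` (used); Mathlib has no Čech cohomology of (pre)sheaves on
schemes beyond degree `0` (`Mathlib/AlgebraicGeometry/Sites`, `CategoryTheory/Sites/SheafCohomology`
have no refinement maps).

## References

* U. Görtz, T. Wedhorn, *Algebraic Geometry II: Cohomology of Schemes*, Springer Spektrum (2023),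
  doi:10.1007/978-3-658-43031-3: (21.16), Def. 21.71 and Lemma 21.72, p. 262; Cor. 21.81, p. 265
  (read via the held copy). [GortzWedhorn2023]
* The Stacks Project, Tag 09UY (refinements and Čech cohomology), Tag 01ED (Cohomology,
  Section 20.9). [StacksProject]
-/

noncomputable section

open CategoryTheory AlgebraicGeometry Limits TopologicalSpace Opposite

universe u v w

namespace Literature.AlgebraicGeometry.Morphisms

variable {A : Type u} [CommRing A] {X : Scheme.{u}} (f : X ⟶ Spec (.of A))

/-! ## Sheaf properties of `Sections` -/

namespace Sections

/-- **Locality**: sections over `V` which agree on a family of opens `W_j ⊆ V` covering `V` are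
equal (the structure sheaf is a sheaf). [folklore] -/
theorem eq_of_res_eq {V : X.Opens} {J : Type*} (W : J → X.Opens) (hW : ∀ j, W j ≤ V)
    (hcov : V ≤ ⨆ j, W j) {s t : Sections f V}
    (h : ∀ j, Sections.res f (hW j) s = Sections.res f (hW j) t) : s = t :=
  X.sheaf.eq_of_locally_eq' W V (fun j => homOfLE (hW j)) hcov s t h

/-- **Gluing**: sections `s_j` over opens `W_j ⊆ V` covering `V` which agree on the overlaps
`W_j ∩ W_{j'}` glue to a section over `V`. [folklore] -/
theorem exists_res_eq {V : X.Opens} {J : Type*} (W : J → X.Opens) (hW : ∀ j, W j ≤ V)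
    (hcov : V ≤ ⨆ j, W j) (s : ∀ j, Sections f (W j))
    (hs : ∀ j j', Sections.res f (inf_le_left : W j ⊓ W j' ≤ W j) (s j) =
      Sections.res f (inf_le_right : W j ⊓ W j' ≤ W j') (s j')) :
    ∃ t : Sections f V, ∀ j, Sections.res f (hW j) t = s j := by
  obtain ⟨t, ht, -⟩ := X.sheaf.existsUnique_gluing' W V (fun j => homOfLE (hW j)) hcov s
    (fun j j' => hs j j')
  exact ⟨t, ht⟩

end Sections

/-! ## Restricting the cocycle identity -/

section Cocycle

variable {ι : Type v} (U : ι → X.Opens)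

/-- The cocycle identity `c_{jk} - c_{ik} + c_{ij} = 0` of a Čech `1`-cocycle, restricted to any
open `W ⊆ U_i ∩ U_j ∩ U_k`. [folklore] -/
theorem cechZ1.cocycle_res {c : CechC1 f U} (hc : c ∈ cechZ1 f U) (i j k : ι) {W : X.Opens}
    (hi : W ≤ U i) (hj : W ≤ U j) (hk : W ≤ U k) :
    Sections.res f (le_inf hj hk) (c j k) - Sections.res f (le_inf hi hk) (c i k) +
      Sections.res f (le_inf hi hj) (c i j) = 0 := by
  have h0 : cechD1 f U c i j k = 0 := by
    rw [(mem_cechZ1_iff f U c).mp hc]; rfl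
  have h1 := congrArg (Sections.res f (le_inf (le_inf hi hj) hk : W ≤ U i ⊓ U j ⊓ U k)) h0
  rw [cechD1_apply, map_add, map_sub, map_zero, Sections.res_res, Sections.res_res,
    Sections.res_res] at h1
  exact h1

/-- A Čech `1`-cocycle vanishes on the diagonal: `c_{ii} = 0` (on any `W ⊆ U_i`). [folklore] -/
theorem cechZ1.res_diag {c : CechC1 f U} (hc : c ∈ cechZ1 f U) (i : ι) {W : X.Opens}
    (hi : W ≤ U i) : Sections.res f (le_inf hi hi) (c i i) = 0 := by
  have h := cechZ1.cocycle_res f U hc i i i hi hi hi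
  rwa [sub_self, zero_add] at h

/-- Two cocycles have the same class in `Ȟ¹` iff they differ by a coboundary. [folklore] -/
theorem CechH1.mk_eq_mk_iff (z z' : cechZ1 f U) :
    CechH1.mk f U z = CechH1.mk f U z' ↔ (z : CechC1 f U) - z' ∈ cechB1 f U := by
  rw [CechH1.mk, Submodule.mkQ_apply, Submodule.mkQ_apply, Submodule.Quotient.eq,
    Submodule.mem_comap]
  rfl

end Cocycle

/-! ## Refinement of families of opens and the induced maps on Čech cochains -/

section Refine

variable {ι : Type v} {ι' : Type w} (U : ι → X.Opens) (V : ι' → X.Opens) (τ : ι' → ι)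
  (hτ : ∀ j, V j ≤ U (τ j))

/-- Refinement on `0`-cochains: `(ρ b)_j = b_{τ j} |_{V_j}`.
[cite: GortzWedhorn2023, (21.16) Def. 21.71 (p. 262)] -/
def cechRefineC0 : CechC0 f U →ₗ[A] CechC0 f V where
  toFun b j := Sections.res f (hτ j) (b (τ j))
  map_add' b b' := by ext j; exact map_add _ (b (τ j)) (b' (τ j))
  map_smul' a b := by ext j; exact map_smul _ a (b (τ j))

/-- Refinement on `1`-cochains: `(ρ c)_{jj'} = c_{τ j, τ j'} |_{V_j ∩ V_{j'}}`.
[cite: GortzWedhorn2023, (21.16) Def. 21.71 (p. 262)] -/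
def cechRefineC1 : CechC1 f U →ₗ[A] CechC1 f V where
  toFun c j j' := Sections.res f (inf_le_inf (hτ j) (hτ j')) (c (τ j) (τ j'))
  map_add' c c' := by ext j j'; exact map_add _ (c (τ j) (τ j')) (c' (τ j) (τ j'))
  map_smul' a c := by ext j j'; exact map_smul _ a (c (τ j) (τ j'))

/-- Refinement on `2`-cochains. [cite: GortzWedhorn2023, (21.16) Def. 21.71 (p. 262)] -/
def cechRefineC2 : CechC2 f U →ₗ[A] CechC2 f V where
  toFun c j j' j'' :=
    Sections.res f (inf_le_inf (inf_le_inf (hτ j) (hτ j')) (hτ j'')) (c (τ j) (τ j') (τ j''))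
  map_add' c c' := by
    ext j j' j''; exact map_add _ (c (τ j) (τ j') (τ j'')) (c' (τ j) (τ j') (τ j''))
  map_smul' a c := by ext j j' j''; exact map_smul _ a (c (τ j) (τ j') (τ j''))

/-- Unfolding of `cechRefineC0`. [folklore] -/
theorem cechRefineC0_apply (b : CechC0 f U) (j : ι') :
    cechRefineC0 f U V τ hτ b j = Sections.res f (hτ j) (b (τ j)) := rfl

/-- Unfolding of `cechRefineC1`. [folklore] -/
theorem cechRefineC1_apply (c : CechC1 f U) (j j' : ι') :
    cechRefineC1 f U V τ hτ c j j' =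
      Sections.res f (inf_le_inf (hτ j) (hτ j')) (c (τ j) (τ j')) := rfl

/-- Unfolding of `cechRefineC2`. [folklore] -/
theorem cechRefineC2_apply (c : CechC2 f U) (j j' j'' : ι') :
    cechRefineC2 f U V τ hτ c j j' j'' =
      Sections.res f (inf_le_inf (inf_le_inf (hτ j) (hτ j')) (hτ j'')) (c (τ j) (τ j') (τ j'')) :=
  rfl

/-- **Refinement commutes with `d⁰`.** [cite: GortzWedhorn2023, (21.16) (p. 262)] -/
theorem cechD0_refineC0 (b : CechC0 f U) :
    cechD0 f V (cechRefineC0 f U V τ hτ b) = cechRefineC1 f U V τ hτ (cechD0 f U b) := by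
  funext j j'
  simp only [cechD0_apply, cechRefineC0_apply, cechRefineC1_apply, map_sub, Sections.res_res]

/-- **Refinement commutes with `d¹`.** [cite: GortzWedhorn2023, (21.16) (p. 262)] -/
theorem cechD1_refineC1 (c : CechC1 f U) :
    cechD1 f V (cechRefineC1 f U V τ hτ c) = cechRefineC2 f U V τ hτ (cechD1 f U c) := by
  funext j j' j''
  simp only [cechD1_apply, cechRefineC1_apply, cechRefineC2_apply, map_sub, map_add,
    Sections.res_res]

/-- Refinement maps cocycles to cocycles. [folklore] -/
theorem refineC1_mem_cechZ1 {c : CechC1 f U} (hc : c ∈ cechZ1 f U) :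
    cechRefineC1 f U V τ hτ c ∈ cechZ1 f V := by
  rw [mem_cechZ1_iff] at hc ⊢
  rw [cechD1_refineC1, hc, map_zero]

/-- Refinement maps coboundaries to coboundaries. [folklore] -/
theorem refineC1_mem_cechB1 {c : CechC1 f U} (hc : c ∈ cechB1 f U) :
    cechRefineC1 f U V τ hτ c ∈ cechB1 f V := by
  rw [mem_cechB1_iff] at hc ⊢
  obtain ⟨b, rfl⟩ := hc
  exact ⟨cechRefineC0 f U V τ hτ b, cechD0_refineC0 f U V τ hτ b⟩

/-- Refinement on cocycles. [folklore] -/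
def cechRefineZ1 : ↥(cechZ1 f U) →ₗ[A] ↥(cechZ1 f V) :=
  (cechRefineC1 f U V τ hτ).restrict fun _ hc => refineC1_mem_cechZ1 f U V τ hτ hc

/-- Unfolding of `cechRefineZ1`. [folklore] -/
@[simp]
theorem cechRefineZ1_coe (z : cechZ1 f U) :
    (cechRefineZ1 f U V τ hτ z : CechC1 f V) = cechRefineC1 f U V τ hτ z := rfl

/-- **The refinement map `Ȟ¹(𝒰, 𝒪_X) → Ȟ¹(𝒱, 𝒪_X)`** of a map of coverings `τ : 𝒱 → 𝒰`.
[cite: GortzWedhorn2023, (21.16) Def. 21.71 (p. 262)] -/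
def cechRefineH1 : CechH1 f U →ₗ[A] CechH1 f V :=
  Submodule.mapQ _ _ (cechRefineZ1 f U V τ hτ) fun z hz => by
    rw [Submodule.mem_comap] at hz ⊢
    exact refineC1_mem_cechB1 f U V τ hτ hz

/-- `ρ[z] = [ρ z]`. [folklore] -/
@[simp]
theorem cechRefineH1_mk (z : cechZ1 f U) :
    cechRefineH1 f U V τ hτ (CechH1.mk f U z) = CechH1.mk f V (cechRefineZ1 f U V τ hτ z) :=
  rfl

/-- `ρ[z] = 0` iff `ρ z` is a coboundary. [folklore] -/
theorem cechRefineH1_mk_eq_zero_iff (z : cechZ1 f U) :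
    cechRefineH1 f U V τ hτ (CechH1.mk f U z) = 0 ↔
      cechRefineC1 f U V τ hτ z ∈ cechB1 f V := by
  rw [cechRefineH1_mk, CechH1.mk_eq_zero_iff, cechRefineZ1_coe]

/-! ## Injectivity of `Ȟ¹` under refinement -/

/-- **Cocycle form of the injectivity of `Ȟ¹(𝒰) → Ȟ¹(𝒱)`**: if `𝒱` covers every `U_i` and the
refinement of a cocycle `c` on `𝒰` is a coboundary `d⁰e` on `𝒱`, then `c` is a coboundary on `𝒰`:
the sections `e_j + c_{τ j, i}` on `U_i ∩ V_j` agree on overlaps (cocycle identity for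
`(τ j, τ j', i)`), glue to `b_i ∈ Γ(U_i)`, and `d⁰ b = c` (cocycle identity for `(τ j, i, i')`,
checked locally on the `V_j`). [cite: GortzWedhorn2023, Cor. 21.81 (p. 265)] -/
theorem mem_cechB1_of_refineC1_mem_cechB1 (hU : ∀ i, U i ≤ ⨆ j, V j) {c : CechC1 f U}
    (hc : c ∈ cechZ1 f U) (hρ : cechRefineC1 f U V τ hτ c ∈ cechB1 f V) : c ∈ cechB1 f U := by
  obtain ⟨e, he⟩ := (mem_cechB1_iff f V _).mp hρ
  -- `he' j j'`: `e_{j'} - e_j = c_{τ j, τ j'}` on `V_j ∩ V_{j'}`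
  have he' : ∀ j j', Sections.res f inf_le_right (e j') - Sections.res f inf_le_left (e j) =
      Sections.res f (inf_le_inf (hτ j) (hτ j')) (c (τ j) (τ j')) := fun j j' => by
    rw [← cechD0_apply, he]; rfl
  -- the cover `(U_i ∩ V_j)_j` of `U_i`
  have hcov : ∀ i, U i ≤ ⨆ j, U i ⊓ V j := fun i => by
    rw [← inf_iSup_eq]; exact le_inf le_rfl (hU i)
  -- local sections `s^i_j = e_j + c_{τ j, i}` on `U_i ∩ V_j`
  set s : ∀ i j, Sections f (U i ⊓ V j) := fun i j =>
    Sections.res f inf_le_right (e j) +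
      Sections.res f (le_inf (inf_le_right.trans (hτ j)) inf_le_left) (c (τ j) i) with hs
  have hglue : ∀ i j j', Sections.res f (inf_le_left : (U i ⊓ V j) ⊓ (U i ⊓ V j') ≤ _) (s i j) =
      Sections.res f (inf_le_right : (U i ⊓ V j) ⊓ (U i ⊓ V j') ≤ _) (s i j') := by
    intro i j j'
    simp only [hs, map_add, Sections.res_res]
    -- `W = (U_i ∩ V_j) ∩ (U_i ∩ V_{j'})`
    have hWi : (U i ⊓ V j) ⊓ (U i ⊓ V j') ≤ U i := inf_le_left.trans inf_le_left
    have hWj : (U i ⊓ V j) ⊓ (U i ⊓ V j') ≤ V j := inf_le_left.trans inf_le_right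
    have hWj' : (U i ⊓ V j) ⊓ (U i ⊓ V j') ≤ V j' := inf_le_right.trans inf_le_right
    have h1 := cechZ1.cocycle_res f U hc (τ j) (τ j') i (hWj.trans (hτ j)) (hWj'.trans (hτ j'))
      hWi
    have h2 := congrArg (Sections.res f (le_inf hWj hWj' : _ ≤ V j ⊓ V j')) (he' j j')
    rw [map_sub, Sections.res_res, Sections.res_res, Sections.res_res] at h2
    -- `e_j + c_{τj,i} = e_{j'} + c_{τj',i}` iff `c_{τj',i} - c_{τj,i} = e_j - e_{j'} = -c_{τj,τj'}`
    linear_combination -h1 - h2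
  choose b hb using fun i => Sections.exists_res_eq f (fun j => U i ⊓ V j) (fun j => inf_le_left)
    (hcov i) (s i) (hglue i)
  refine (mem_cechB1_iff f U c).mpr ⟨b, ?_⟩
  funext i i'
  -- check `b_{i'} - b_i = c_{i i'}` on `U_i ∩ U_{i'}` locally on the `V_j`
  apply Sections.eq_of_res_eq f (fun j => (U i ⊓ U i') ⊓ V j) (fun j => inf_le_left)
  · rw [← inf_iSup_eq]; exact le_inf le_rfl (inf_le_left.trans (hU i))
  intro j
  have hWi : (U i ⊓ U i') ⊓ V j ≤ U i := inf_le_left.trans inf_le_left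
  have hWi' : (U i ⊓ U i') ⊓ V j ≤ U i' := inf_le_left.trans inf_le_right
  have hWj : (U i ⊓ U i') ⊓ V j ≤ V j := inf_le_right
  have hbi := congrArg (Sections.res f (le_inf hWi hWj : _ ≤ U i ⊓ V j)) (hb i j)
  have hbi' := congrArg (Sections.res f (le_inf hWi' hWj : _ ≤ U i' ⊓ V j)) (hb i' j)
  simp only [hs, map_add, Sections.res_res] at hbi hbi'
  rw [cechD0_apply, map_sub, Sections.res_res, Sections.res_res]
  erw [hbi, hbi']
  have h1 := cechZ1.cocycle_res f U hc (τ j) i i' (hWj.trans (hτ j)) hWi hWi'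
  linear_combination -h1

/-- **Injectivity of `Ȟ¹(𝒰, 𝒪_X) → Ȟ¹(𝒱, 𝒪_X)` under refinement**, for `𝒱` covering every `U_i`
(for open coverings of a space: Görtz–Wedhorn II, Cor. 21.81, `Ȟ¹(𝒰, 𝓕) ↪ Ȟ¹(X, 𝓕) ≅ H¹(X, 𝓕)`).
[cite: GortzWedhorn2023, Cor. 21.81 (p. 265)] -/
theorem cechRefineH1_injective (hU : ∀ i, U i ≤ ⨆ j, V j) :
    Function.Injective (cechRefineH1 f U V τ hτ) := by
  rw [← LinearMap.ker_eq_bot, LinearMap.ker_eq_bot']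
  intro x hx
  obtain ⟨z, rfl⟩ := CechH1.mk_surjective f U x
  rw [cechRefineH1_mk_eq_zero_iff] at hx
  rw [CechH1.mk_eq_zero_iff]
  exact mem_cechB1_of_refineC1_mem_cechB1 f U V τ hτ hU z.2 hx

/-- Equivalently: `ρ x = 0` implies `x = 0`. [folklore] -/
theorem eq_zero_of_cechRefineH1_eq_zero (hU : ∀ i, U i ≤ ⨆ j, V j) {x : CechH1 f U}
    (hx : cechRefineH1 f U V τ hτ x = 0) : x = 0 :=
  cechRefineH1_injective f U V τ hτ hU (by rw [hx, map_zero])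

/-! ## `Ȟ¹ = 0` when one member contains all the others -/

/-- If some member `U_{i₀}` contains every `U_i` (e.g. `U_{i₀} = X`), every Čech `1`-cocycle on
`𝒰` is a coboundary: `c = d⁰ b` with `b_i = c_{i₀ i}` (Görtz–Wedhorn II, proof of Lemma 21.76:
the contracting homotopy `h(s)_{i_0 … i_n} = s_{i^0 i_0 … i_n}`). [cite: GortzWedhorn2023, Lemma 21.76 proof (p. 263)] -/
theorem cechZ1_le_cechB1_of_forall_le (i₀ : ι) (h : ∀ i, U i ≤ U i₀) :
    cechZ1 f U ≤ cechB1 f U := by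
  intro c hc
  refine (mem_cechB1_iff f U c).mpr ⟨fun i => Sections.res f (le_inf (h i) le_rfl) (c i₀ i), ?_⟩
  funext i i'
  rw [cechD0_apply, Sections.res_res, Sections.res_res]
  have h1 := cechZ1.cocycle_res f U hc i₀ i i' (inf_le_left.trans (h i)) inf_le_left inf_le_right
  rw [Sections.res_self] at h1
  linear_combination -h1

/-- Hence `Ȟ¹(𝒰, 𝒪_X) = 0` when one member contains all the others. [folklore] -/
theorem cechH1_eq_zero_of_forall_le (i₀ : ι) (h : ∀ i, U i ≤ U i₀) (x : CechH1 f U) : x = 0 := by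
  obtain ⟨z, rfl⟩ := CechH1.mk_surjective f U x
  rw [CechH1.mk_eq_zero_iff]
  exact cechZ1_le_cechB1_of_forall_le f U i₀ h z.2

end Refine

/-! ## Refinement commutes with pullback -/

section Comap

variable {Y : Scheme.{u}} (fY : Y ⟶ Spec (.of A)) (g : Y ⟶ X) (hg : g ≫ f = fY)
variable {ι : Type v} {ι' : Type w} (U : ι → X.Opens) (V : ι' → X.Opens) (τ : ι' → ι)
  (hτ : ∀ j, V j ≤ U (τ j))

/-- **`g^*` commutes with refinement on `1`-cochains** (`g⁻¹𝒱` refines `g⁻¹𝒰` by the same map of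
index sets). [folklore] -/
theorem cechComapC1_refineC1 (c : CechC1 f U) :
    cechComapC1 f fY g hg V (cechRefineC1 f U V τ hτ c) =
      cechRefineC1 fY (preimageFamily g U) (preimageFamily g V) τ (fun j _ hx => hτ j hx)
        (cechComapC1 f fY g hg U c) := by
  funext j j'
  simp only [cechComapC1_apply, cechRefineC1_apply, Sections.comap_res]
  erw [Sections.res_comap]
  rfl

/-- **`g^*` commutes with refinement on `Ȟ¹`**: `g^* ∘ ρ_τ = ρ_τ ∘ g^*`. [folklore] -/
theorem cechComapH1_refineH1 (x : CechH1 f U) :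
    cechComapH1 f fY g hg V (cechRefineH1 f U V τ hτ x) =
      cechRefineH1 fY (preimageFamily g U) (preimageFamily g V) τ (fun j _ hx => hτ j hx)
        (cechComapH1 f fY g hg U x) := by
  obtain ⟨z, rfl⟩ := CechH1.mk_surjective f U x
  rw [cechRefineH1_mk, cechComapH1_mk, cechComapH1_mk, cechRefineH1_mk]
  congr 1
  ext : 1
  simp only [cechComapZ1_coe, cechRefineZ1_coe]
  exact cechComapC1_refineC1 f fY g hg U V τ hτ z

end Comap

end Literature.AlgebraicGeometry.Morphisms

end
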